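import Summits.Ventures.PercRepro.RankLevelSetRuleQCellOne
import Summits.Ventures.PercRepro.RankLevelSetRuleQCellEnds
import Summits.Ventures.PercRepro.RankLevelSetRuleQRhatFalse

/-!
# PercRepro — (R̂) HOLDS ON EVERY CELL `(q+2, q)`: RULE Q AND THE UP-HALL FORM FOR THE WHOLE CELL `k = 2`, EVERY `q ≥ 1`
(p4, gen 20; paper proofs/P4-SLICE-ONE.md §5)

For `k = 2` the inequality (R̂) of RankLevelSetRuleQRhat reads, for `m ≤ q − 1`,
`(q+2)/(q+1) ≤ (q − m + 2)·S(q, m)`, `S(q, m) := Σ_{a ≤ m} C(m, a)/C(q+1+a, a+1)` (`m̂(q, m; a, 1) = C(q+a, a) + C(q+a, a+1)`),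
and `m = q` is RuleQCellEnds' `rhatCell_self`. Two classical identities do the rest:
* `Σ_{a ≤ m} C(m, a)/C(q+a, a) = (Σ_{i ≤ m} C(q+m, i))/C(q+m, m)` (`sum_choose_div_choose_eq`, from
  `C(m, a)·C(q+m, m) = C(q+m, m−a)·C(q+a, a)`), and
* `1/C(q+1+a, a+1) = 1/C(q+a, a) − (q/(q+1))·1/C(q+1+a, a)`,
so `S(q, m) = ((m+1)·C(q+m, m) − (q−m−1)·Σ_{i<m} C(q+m, i)) / ((q+m+1)·C(q+m, m))`; the geometric tail
`(q−m+1)·Σ_{i<m} C(q+m, i) ≤ m·C(q+m, m)` (`geom_tail`) gives **`S(q, m) ≥ 1/(q − m + 1)`** (`cellTwo_sum_ge`), hence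
`(q−m+2)·S ≥ (q−m+2)/(q−m+1) ≥ (q+2)/(q+1)`.
* **`rhatCell_two`** — `RhatCell q 2` for every `q ≥ 1` (the first cell family with (R̂) for EVERY `m`);
* **`ruleQUp_two`** / **`hallUp_two`** — Rule Q pays `Φ(q+2, q)` to EVERY member, and the UP-Hall form holds, at the tight
  layer `#E = (q+2) + q` of every finite matroid, for every `q ≥ 1` (via RankLevelSetRuleQCell's transfer).
Twin: lean-drafts/p4/g20/slice/twin/k2.py (ratio `R̂(q,2,m)/Φ ≥ 1` for all `m ≤ q ≤ 40`, equality only at `m = 0`). Axioms: standard.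
-/

namespace PercRepro

open Finset

/-! ### §1 Two classical identities -/

/-- `C(m, a)·C(q+m, m) = C(q+m, m−a)·C(q+a, a)` for `a ≤ m`. -/
lemma choose_mul_choose_symm_eq (q m a : ℕ) (ha : a ≤ m) :
    m.choose a * (q + m).choose m = (q + m).choose (m - a) * (q + a).choose a := by
  have h1 := Nat.choose_mul (n := q + m) (k := m) (s := a) ha
  have h2 := Nat.choose_mul (n := q + m) (k := q + a) (s := a) (by omega)
  rw [show q + a - a = q by omega] at h2
  have h3 : (q + m - a).choose (m - a) = (q + m - a).choose q := by
    rw [show q + m - a = q + (m - a) by omega]; exact Nat.choose_symm_add.symm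
  have h4 : (q + m).choose (q + a) = (q + m).choose (m - a) :=
    Nat.choose_symm_of_eq_add (by omega)
  calc m.choose a * (q + m).choose m = (q + m).choose m * m.choose a := by ring
    _ = (q + m).choose a * (q + m - a).choose (m - a) := h1
    _ = (q + m).choose a * (q + m - a).choose q := by rw [h3]
    _ = (q + m).choose (q + a) * (q + a).choose a := h2.symm
    _ = (q + m).choose (m - a) * (q + a).choose a := by rw [h4]

/-- `Σ_{a ≤ m} C(m, a)/C(q+a, a) = (Σ_{i ≤ m} C(q+m, i)) / C(q+m, m)`. -/
lemma sum_choose_div_choose_eq (q m : ℕ) :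
    ∑ a ∈ range (m + 1), (m.choose a : ℚ) / ((q + a).choose a : ℚ)
      = (∑ i ∈ range (m + 1), ((q + m).choose i : ℚ)) / ((q + m).choose m : ℚ) := by
  have hrefl := Finset.sum_range_reflect (fun i => ((q + m).choose i : ℚ)) (m + 1)
  rw [← hrefl, Finset.sum_div]
  refine Finset.sum_congr rfl (fun a ha => ?_)
  rw [Finset.mem_range] at ha
  rw [show m + 1 - 1 - a = m - a by omega]
  rw [div_eq_div_iff (by exact_mod_cast (Nat.choose_pos (by omega : a ≤ q + a)).ne')
    (by exact_mod_cast (Nat.choose_pos (by omega : m ≤ q + m)).ne')]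
  exact_mod_cast choose_mul_choose_symm_eq q m a (by omega)

/-- Pascal for partial sums: `Σ_{i ≤ m} C(n+1, i) = Σ_{i ≤ m} C(n, i) + Σ_{i < m} C(n, i)`. -/
lemma sum_choose_succ_eq (n m : ℕ) :
    ∑ i ∈ range (m + 1), (n + 1).choose i
      = ∑ i ∈ range (m + 1), n.choose i + ∑ i ∈ range m, n.choose i := by
  induction m with
  | zero => simp
  | succ m ih =>
    rw [Finset.sum_range_succ, ih, Finset.sum_range_succ (fun i => n.choose i) (m + 1),
      Finset.sum_range_succ (fun i => n.choose i) m, Nat.choose_succ_succ]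
    ring

/-- The geometric tail of the row `C(q+m, ·)` below `m ≤ q`: `(q − m + 1)·Σ_{i < j} C(q+m, i) ≤ m·C(q+m, j)` for `j ≤ m`. -/
lemma geom_tail (q m : ℕ) (hm : m ≤ q) :
    ∀ j ≤ m, (q - m + 1) * ∑ i ∈ range j, (q + m).choose i ≤ m * (q + m).choose j := by
  intro j
  induction j with
  | zero => intro _; simp
  | succ j ih =>
    intro hj
    have ih' := ih (by omega)
    have hstep : (q + 1) * (q + m).choose j ≤ m * (q + m).choose (j + 1) := by
      have h := Nat.choose_succ_right_eq (q + m) j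
      have hpoly : (q + 1) * (j + 1) ≤ m * (q + m - j) := by
        have h1 : q + 1 ≤ q + m - j := by omega
        calc (q + 1) * (j + 1) ≤ (q + m - j) * m := Nat.mul_le_mul h1 (by omega)
          _ = m * (q + m - j) := by ring
      have h2 : (q + 1) * (q + m).choose j * (j + 1) ≤ m * (q + m).choose (j + 1) * (j + 1) := by
        calc (q + 1) * (q + m).choose j * (j + 1) = (q + m).choose j * ((q + 1) * (j + 1)) := by ring
          _ ≤ (q + m).choose j * (m * (q + m - j)) := Nat.mul_le_mul_left _ hpoly
          _ = m * ((q + m).choose j * (q + m - j)) := by ring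
          _ = m * ((q + m).choose (j + 1) * (j + 1)) := by rw [h]
          _ = m * (q + m).choose (j + 1) * (j + 1) := by ring
      exact Nat.le_of_mul_le_mul_right h2 (by omega)
    rw [Finset.sum_range_succ, mul_add]
    calc (q - m + 1) * ∑ i ∈ range j, (q + m).choose i + (q - m + 1) * (q + m).choose j
        ≤ m * (q + m).choose j + (q - m + 1) * (q + m).choose j := Nat.add_le_add_right ih' _
      _ = (q + 1) * (q + m).choose j := by
          rw [← add_mul, show m + (q - m + 1) = q + 1 by omega]
      _ ≤ m * (q + m).choose (j + 1) := hstep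

/-! ### §2 The slice sum of the cell `(q+2, q)` -/

/-- The termwise decomposition `1/C(q+1+a, a+1) = 1/C(q+a, a) − (q/(q+1))/C(q+1+a, a)`. -/
lemma one_div_choose_succ_eq (q a : ℕ) :
    (1 : ℚ) / ((q + 1 + a).choose (a + 1) : ℚ)
      = 1 / ((q + a).choose a : ℚ) - (q : ℚ) / (q + 1) * (1 / ((q + 1 + a).choose a : ℚ)) := by
  have e1 : ((q + a).choose a : ℚ) * (q + a + 1) = ((q + a + 1).choose a : ℚ) * (q + 1) := by
    have h := Nat.choose_mul_succ_eq (q + a) a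
    rw [show q + a + 1 - a = q + 1 by omega] at h
    exact_mod_cast h
  have e2 : ((q + a + 1 : ℕ) : ℚ) * ((q + a).choose a : ℚ) = ((q + a + 1).choose (a + 1) : ℚ) * (a + 1) := by
    have h := Nat.add_one_mul_choose_eq (q + a) a
    exact_mod_cast h
  have hX : (0 : ℚ) < (q + a).choose a := by exact_mod_cast Nat.choose_pos (by omega)
  have hY : (0 : ℚ) < (q + a + 1).choose a := by exact_mod_cast Nat.choose_pos (by omega)
  have hZ : (0 : ℚ) < (q + a + 1).choose (a + 1) := by exact_mod_cast Nat.choose_pos (by omega)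
  rw [show q + 1 + a = q + a + 1 by ring]
  push_cast at e2
  have hZ' : (1 : ℚ) / ((q + a + 1).choose (a + 1) : ℚ) = (a + 1) / ((q + a + 1) * ((q + a).choose a : ℚ)) := by
    rw [div_eq_div_iff hZ.ne' (by positivity)]
    linarith [e2]
  have hY' : (q : ℚ) / (q + 1) * (1 / ((q + a + 1).choose a : ℚ)) = q / ((q + a + 1) * ((q + a).choose a : ℚ)) := by
    rw [div_mul_div_comm, mul_one, div_eq_div_iff (by positivity) (by positivity)]
    linear_combination (q : ℚ) * e1
  rw [hZ', hY']
  field_simp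
  ring

/-- **`S(q, m) ≥ 1/(q − m + 1)`** for `m ≤ q − 1` (stated with `q = m + v + 1`):
`1/(v+2) ≤ Σ_{a ≤ m} C(m, a)/C(q+1+a, a+1)`. -/
lemma cellTwo_sum_ge (m v : ℕ) :
    (1 : ℚ) / (v + 2)
      ≤ ∑ a ∈ range (m + 1), (m.choose a : ℚ) / ((m + v + 1 + 1 + a).choose (a + 1) : ℚ) := by
  have hsplit : ∑ a ∈ range (m + 1), (m.choose a : ℚ) / ((m + v + 1 + 1 + a).choose (a + 1) : ℚ)
      = ∑ a ∈ range (m + 1), (m.choose a : ℚ) / ((m + v + 1 + a).choose a : ℚ)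
        - ((m : ℚ) + v + 1) / ((m : ℚ) + v + 1 + 1)
          * ∑ a ∈ range (m + 1), (m.choose a : ℚ) / ((m + v + 1 + 1 + a).choose a : ℚ) := by
    rw [Finset.mul_sum, ← Finset.sum_sub_distrib]
    refine Finset.sum_congr rfl (fun a _ => ?_)
    have h := one_div_choose_succ_eq (m + v + 1) a
    push_cast at h
    calc (m.choose a : ℚ) / ((m + v + 1 + 1 + a).choose (a + 1) : ℚ)
        = (m.choose a : ℚ) * (1 / ((m + v + 1 + 1 + a).choose (a + 1) : ℚ)) := by ring
      _ = (m.choose a : ℚ) * (1 / ((m + v + 1 + a).choose a : ℚ)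
            - ((m : ℚ) + v + 1) / ((m : ℚ) + v + 1 + 1) * (1 / ((m + v + 1 + 1 + a).choose a : ℚ))) := by
          rw [h]
      _ = _ := by ring
  rw [hsplit, sum_choose_div_choose_eq, sum_choose_div_choose_eq]
  have hP := sum_choose_succ_eq (m + v + 1 + m) m
  rw [Finset.sum_range_succ (fun i => (m + v + 1 + m).choose i) m] at hP
  rw [show m + v + 1 + 1 + m = m + v + 1 + m + 1 by ring,
    Finset.sum_range_succ (fun i => ((m + v + 1 + m).choose i : ℚ)) m]
  have hPsum : (∑ i ∈ range (m + 1), ((m + v + 1 + m + 1).choose i : ℚ))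
      = 2 * (∑ i ∈ range m, ((m + v + 1 + m).choose i : ℚ)) + ((m + v + 1 + m).choose m : ℚ) := by
    have h' : ((∑ i ∈ range (m + 1), (m + v + 1 + m + 1).choose i : ℕ) : ℚ)
        = ((∑ i ∈ range m, (m + v + 1 + m).choose i + (m + v + 1 + m).choose m
            + ∑ i ∈ range m, (m + v + 1 + m).choose i : ℕ) : ℚ) := by rw [hP]
    push_cast at h'
    rw [h']; ring
  rw [hPsum]
  set C := (m + v + 1 + m).choose m with hC
  set D := (m + v + 1 + m + 1).choose m with hD
  set P := ∑ i ∈ range m, ((m + v + 1 + m).choose i : ℚ) with hPdef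
  have hDC : (D : ℚ) * (m + v + 1 + 1) = (C : ℚ) * (m + v + 1 + m + 1) := by
    have h := Nat.choose_mul_succ_eq (m + v + 1 + m) m
    rw [show m + v + 1 + m + 1 - m = m + v + 1 + 1 by omega] at h
    exact_mod_cast h.symm
  have hgeom := geom_tail (m + v + 1) m (by omega) m le_rfl
  rw [show m + v + 1 - m + 1 = v + 2 by omega] at hgeom
  have hgeom' : ((v : ℚ) + 2) * P ≤ m * C := by
    have : (((v + 2) * ∑ i ∈ range m, (m + v + 1 + m).choose i : ℕ) : ℚ) ≤ ((m * (m + v + 1 + m).choose m : ℕ) : ℚ) := by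
      exact_mod_cast hgeom
    push_cast at this
    linarith [this]
  have hCpos : (0 : ℚ) < C := by exact_mod_cast Nat.choose_pos (by omega)
  have hDpos : (0 : ℚ) < D := by exact_mod_cast Nat.choose_pos (by omega)
  have hPnn : (0 : ℚ) ≤ P := by positivity
  have hDval : (D : ℚ) = C * (m + v + 1 + m + 1) / (m + v + 1 + 1) := by
    rw [eq_div_iff (by positivity)]; exact hDC
  rw [hDval]
  have key : (P + C : ℚ) / C
      - ((m : ℚ) + v + 1) / ((m : ℚ) + v + 1 + 1) * ((2 * P + C) / (C * (m + v + 1 + m + 1) / (m + v + 1 + 1)))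
      = ((m + 1) * C - v * P) / (C * (m + v + 1 + m + 1)) := by
    field_simp
    ring
  rw [key, div_le_div_iff₀ (by positivity) (by positivity)]
  nlinarith [mul_le_mul_of_nonneg_left hgeom' (by positivity : (0 : ℚ) ≤ v), hCpos]

/-! ### §3 The cell `(q+2, q)` -/

/-- `Φ(q+2, q) = (q+2)/(q+1)`. -/
lemma phiK_two (q : ℕ) : phiK (q + 2) q = (q + 2 : ℚ) / (q + 1) := by
  rw [phiK_eq_sum_range q 2 (by omega)]
  simp only [Nat.add_one_sub_one, Finset.sum_range_one, zero_add, Nat.choose_one_right, add_zero]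
  have : (q + 1).choose q = q + 1 := by rw [Nat.choose_symm_add, Nat.choose_one_right]
  rw [this]; push_cast; ring

/-- On the cell `(q+2, q)` with `m ≤ q − 1`: `m̂(q, m; a, 1) = C(q+1+a, a+1)`. -/
lemma mhat_two (m v a : ℕ) : mhat (m + v + 1) m a 1 = (m + v + 1 + 1 + a).choose (a + 1) := by
  rw [mhat_eq, show m + v + 1 - m = v + 1 by omega, show min 1 (v + 1) = 1 by omega]
  simp only [Finset.sum_range_succ, Finset.sum_range_zero, Nat.choose_zero_right, Nat.choose_one_right,
    add_zero, zero_add, one_mul]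
  rw [show m + v + 1 + 1 + a = m + v + 1 + a + 1 by ring, Nat.choose_succ_succ]

/-- **(R̂) on the whole cell `(q+2, q)`**: `RhatCell q 2` for every `q ≥ 1`. -/
theorem rhatCell_two (q : ℕ) (hq : 1 ≤ q) : RhatCell q 2 := by
  intro m hm
  rcases Nat.eq_or_lt_of_le hm with rfl | hlt
  · exact rhatCell_self m 2 le_rfl
  obtain ⟨v, rfl⟩ : ∃ v, q = m + v + 1 := ⟨q - m - 1, by omega⟩
  rw [phiK_two]
  unfold rhat
  rw [sum_Ioo_nat]
  simp only [zero_add, add_zero, Nat.add_one_sub_one, Finset.sum_range_one]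
  simp only [mhat_two, show m + v + 1 + 2 - m = v + 3 by omega, Nat.choose_one_right]
  push_cast
  have hrw : ∑ a ∈ range (m + 1), ((m.choose a : ℚ) * ((v : ℚ) + 3)) / ((m + v + 1 + 1 + a).choose (a + 1) : ℚ)
      = ((v : ℚ) + 3) * ∑ a ∈ range (m + 1), (m.choose a : ℚ) / ((m + v + 1 + 1 + a).choose (a + 1) : ℚ) := by
    rw [Finset.mul_sum]; exact Finset.sum_congr rfl (fun a _ => by ring)
  rw [hrw]
  have hS := cellTwo_sum_ge m v
  calc ((m : ℚ) + v + 1 + 2) / (m + v + 1 + 1) ≤ ((v : ℚ) + 3) * (1 / (v + 2)) := by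
        rw [mul_one_div, div_le_div_iff₀ (by positivity) (by positivity)]
        nlinarith [(by positivity : (0 : ℚ) ≤ m)]
    _ ≤ ((v : ℚ) + 3) * ∑ a ∈ range (m + 1), (m.choose a : ℚ) / ((m + v + 1 + 1 + a).choose (a + 1) : ℚ) :=
        mul_le_mul_of_nonneg_left hS (by positivity)

variable {α : Type} (M : Matroid α) [M.Finite]

/-- **Rule Q pays `Φ(q+2, q)` to EVERY member of the cell `(q+2, q)`** of every finite matroid at the tight layer
`#E = (q+2) + q`, for every `q ≥ 1`. -/
theorem ruleQUp_two (q : ℕ) (hq : 1 ≤ q) (hE : M.E.ncard = (q + 2) + q) : RuleQUp M (q + 2) q :=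
  ruleQUp_of_ncard_eq_of_rhatCell M (rhatCell_two q hq) hE

/-- **The UP-Hall form of C-044 on the whole cell `(q+2, q)`** at the tight layer of every finite matroid, every `q ≥ 1`. -/
theorem hallUp_two (q : ℕ) (hq : 1 ≤ q) (hE : M.E.ncard = (q + 2) + q) (𝒜 : Set (Set α))
    (h𝒜 : 𝒜 ⊆ cellMembers M (q + 2) q) :
    phiK (q + 2) q * (𝒜.ncard : ℚ) ≤ ((upNbhd M (q + 2) q 𝒜).ncard : ℚ) :=
  hallUp_of_ncard_eq_of_rhatCell M (rhatCell_two q hq) hE 𝒜 h𝒜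

end PercRepro
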